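import Summits.AnomalousDissipation.AnomalousDissipation.Theses.PumpedMirror
import Summits.AnomalousDissipation.AnomalousDissipation.Theorems.TaylorGreenLoudGalerkinStates.Negative.Anatomy
import Literature.Analysis.FluidPDE.StatisticalSolutionDirac
import Literature.Analysis.FluidPDE.SteadyNavierStokesEnergy
import Literature.Analysis.FunctionSpaces.TorusSpectralWeakDerivative

/-!
# `PumpedMirror.MirrorFloorTG` (stmt-AnomalousDissipation-15372) — negative side:
# the state of rest and the steady-state kill switch

Crux-attack (vetting) seat `refuter-rattack-stmt-AnomalousDissipation-15372-0`, 2026-08-17. Kernel-checked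
facts about the crux A = LOW-ENERGY MIRROR FLOOR of route `PumpedMirror`; nothing in this file asserts a
Theses statement.

* `coe_rest`, `eGradNormSq_rest`, `rest_mem_slab` — NON-VACUITY: the state of rest `0 ∈ H` satisfies the
  three hypotheses of the floor (its `L²` representative is the zero field pointwise, so it is a.e.
  K-symmetric; zero enstrophy; energy `≤ E`) at every level `E ≥ 0`.
* `certificate_at_rest` — at rest every certificate `(Φ₁, θ₁)` is worth exactly the drift
  `(f_TG, Φ₁'(0)) = ∫ ⟪f_TG, Φ₁'(0)⟫`: the dissipation, the viscous pairing, the Reynolds-stress pairing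
  and the energy channel all vanish there. Hence `floor_at_rest_iff` and
  `not_floor_at_rest_of_drift_nonpos`: the energy multiplier `θ₁` certifies nothing by itself, and a
  test functional whose differential at rest does not correlate positively with `f_TG` certifies no
  positive floor — the generator term `⟨F(u), Φ₁'(u)⟩` is load-bearing (the floor is not a
  `positivity` consequence of `D ≥ 0`).
* `steadyStates_loud_of_mirrorFloorTG` — NECESSARY CONDITION (the typed `TargetImpliesSteady` pattern of
  the route header): `MirrorFloorTG` forces every steady weak solution `u ∈ V` of NS_ν(f_TG) whose
  representative is a.e. K-symmetric and whose energy is `≤ E` to dissipate `ν‖∇u‖² ≥ ε₀(E)` for all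
  `ν < ν₀(E)`: at a steady state the generator pairing vanishes on `Φ₁'(u) ∈ 𝒱`
  (`CylindricalTest.isSmooth_grad_holds` & co.) and the energy channel `(u, f_TG) − ν‖∇u‖²` vanishes by
  Temam's energy equation for steady weak solutions in `V`, `d ≤ 4` (`IsSteadyWeakSolution.energy_eq'`).
* `not_mirrorFloorTG_of_quietSteadyStates` — KILL SWITCH for refuters: ONE level `E` and a sequence of
  a.e. K-symmetric steady weak solutions `uₙ ∈ V` of NS_{νₙ}(f_TG) along `νₙ → 0⁺` with `‖uₙ‖² ≤ E` and
  `νₙ ‖∇uₙ‖² → 0` refutes the crux (no measure theory needed, unlike the relaxed-statistics socket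
  `Cruxes/MirrorFloorTG/StrategistCensusS1.not_mirrorFloorTG_of_quiet`). The in-tree Newton census of
  steady K-branches (energy `~ ν^{-0.7}`, `νW ≈ 0.25`; quoted in
  `Theorems/MirrorStatisticsLoudTG/Negative/LoadBearing`) provides no such sequence: the computed branches
  run away in energy and stay loud.
-/

noncomputable section

open MeasureTheory Filter Topology UnitAddTorus
open scoped InnerProductSpace RealInnerProductSpace ENNReal NNReal

set_option linter.dupNamespace false

namespace Summit.AnomalousDissipation.AnomalousDissipation.Theorems.MirrorFloorTG.Negative

open Literature.Analysis.FunctionSpaces Literature.Analysis.FunctionSpaces.Torus Literature.Analysis.FluidPDE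
open Summit.AnomalousDissipation.AnomalousDissipation.Theses.PumpedMirror
open Summit.AnomalousDissipation.AnomalousDissipation.Theorems.TaylorGreenLoudGalerkinStates.Negative
  (tgForce isSmooth_tgForce)

/-! ## §1 The state of rest lies in the mirror slab (non-vacuity of the hypotheses) -/

/-- The `L²` representative of the state of rest `0 ∈ H` is the zero field, pointwise (Mathlib's
`AEEqFun.cast` represents a constant class by the constant function). -/
theorem coe_rest : (((0 : Torus.energySpace (Fin 3)) : Lp (EuclideanSpace ℝ (Fin 3)) 2 (volume : Measure (UnitAddTorus (Fin 3)))) : (UnitAddTorus (Fin 3) → EuclideanSpace ℝ (Fin 3))) = 0 := by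
  funext x; simp

/-- The zero field has zero spectral enstrophy. -/
theorem eGradNormSq_zero_field : Torus.eGradNormSq (0 : (UnitAddTorus (Fin 3) → EuclideanSpace ℝ (Fin 3))) = 0 := by
  rw [Torus.eGradNormSq_eq_tsum]
  have hc : (⇑(EuclideanSpace.complexify (ι := Fin 3)) ∘ (0 : (UnitAddTorus (Fin 3) → EuclideanSpace ℝ (Fin 3)))) =
      (0 : UnitAddTorus (Fin 3) → EuclideanSpace ℂ (Fin 3)) := by
    funext x; simp
  have h : ∀ k : Fin 3 → ℤ,
      UnitAddTorus.mFourierCoeff (0 : UnitAddTorus (Fin 3) → EuclideanSpace ℂ (Fin 3)) k = 0 := by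
    intro k
    rw [Torus.mFourierCoeff_eq_integral_volume]
    simp
  simp [hc, h]

/-- The state of rest has zero spectral enstrophy. -/
theorem eGradNormSq_rest : Torus.eGradNormSq (((0 : Torus.energySpace (Fin 3)) : Lp (EuclideanSpace ℝ (Fin 3)) 2 (volume : Measure (UnitAddTorus (Fin 3)))) : (UnitAddTorus (Fin 3) → EuclideanSpace ℝ (Fin 3))) = 0 := by
  rw [coe_rest, eGradNormSq_zero_field]

/-- **Non-vacuity.** The state of rest satisfies the three hypotheses of the floor of `MirrorFloorTG`
(a.e. K-symmetry of the representative, finite enstrophy, energy below the level) at every level `E ≥ 0`. -/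
theorem rest_mem_slab {E : ℝ} (hE : 0 ≤ E) :
    (∀ i j : Fin 3, (fun x => (((0 : Torus.energySpace (Fin 3)) : Lp (EuclideanSpace ℝ (Fin 3)) 2 (volume : Measure (UnitAddTorus (Fin 3)))) : (UnitAddTorus (Fin 3) → EuclideanSpace ℝ (Fin 3))) (Function.update x i (-x i)) j) =ᵐ[volume]
        (fun x => if j = i then -((((0 : Torus.energySpace (Fin 3)) : Lp (EuclideanSpace ℝ (Fin 3)) 2 (volume : Measure (UnitAddTorus (Fin 3)))) : (UnitAddTorus (Fin 3) → EuclideanSpace ℝ (Fin 3))) x j) else (((0 : Torus.energySpace (Fin 3)) : Lp (EuclideanSpace ℝ (Fin 3)) 2 (volume : Measure (UnitAddTorus (Fin 3)))) : (UnitAddTorus (Fin 3) → EuclideanSpace ℝ (Fin 3))) x j)) ∧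
      Torus.eGradNormSq (((0 : Torus.energySpace (Fin 3)) : Lp (EuclideanSpace ℝ (Fin 3)) 2 (volume : Measure (UnitAddTorus (Fin 3)))) : (UnitAddTorus (Fin 3) → EuclideanSpace ℝ (Fin 3))) ≠ ⊤ ∧ ‖(0 : Torus.energySpace (Fin 3))‖ ^ 2 ≤ E := by
  refine ⟨fun i j => ae_of_all _ fun x => by simp, ?_, by simpa using hE⟩
  rw [eGradNormSq_rest]
  exact ENNReal.zero_ne_top

/-! ## §2 What every certificate is worth at rest -/

/-- **At rest every certificate is worth the drift.** For every viscosity `ν`, weight `θ` and test field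
`W`, the certified quantity `D + ⟨F(0), W⟩ + 2θ((0, f) − D)` at the state of rest equals
`∫ ⟪f, W⟫`: dissipation, viscous pairing, Reynolds-stress pairing and energy channel all vanish. -/
theorem certificate_at_rest (ν θ : ℝ) (f W : (UnitAddTorus (Fin 3) → EuclideanSpace ℝ (Fin 3))) :
    ν * (Torus.eGradNormSq (((0 : Torus.energySpace (Fin 3)) : Lp (EuclideanSpace ℝ (Fin 3)) 2 (volume : Measure (UnitAddTorus (Fin 3)))) : (UnitAddTorus (Fin 3) → EuclideanSpace ℝ (Fin 3)))).toReal + Torus.nsGeneratorPairing ν f (0 : Torus.energySpace (Fin 3)) W +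
        2 * θ * (Torus.pairing ((0 : Torus.energySpace (Fin 3)) : Lp (EuclideanSpace ℝ (Fin 3)) 2 (volume : Measure (UnitAddTorus (Fin 3)))) f - ν * (Torus.eGradNormSq (((0 : Torus.energySpace (Fin 3)) : Lp (EuclideanSpace ℝ (Fin 3)) 2 (volume : Measure (UnitAddTorus (Fin 3)))) : (UnitAddTorus (Fin 3) → EuclideanSpace ℝ (Fin 3)))).toReal) =
      ∫ x, ⟪f x, W x⟫_ℝ := by
  have h2 : (∫ x, ⟪(((0 : Torus.energySpace (Fin 3)) : Lp (EuclideanSpace ℝ (Fin 3)) 2 (volume : Measure (UnitAddTorus (Fin 3)))) : (UnitAddTorus (Fin 3) → EuclideanSpace ℝ (Fin 3))) x, Torus.laplacian W x⟫_ℝ) = 0 := by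
    simp
  have h3 : Torus.inertialPairing ((0 : Torus.energySpace (Fin 3)) : Lp (EuclideanSpace ℝ (Fin 3)) 2 (volume : Measure (UnitAddTorus (Fin 3)))) W = 0 := by
    unfold Torus.inertialPairing
    simp
  have h4 : Torus.pairing ((0 : Torus.energySpace (Fin 3)) : Lp (EuclideanSpace ℝ (Fin 3)) 2 (volume : Measure (UnitAddTorus (Fin 3)))) f = 0 := by
    unfold Torus.pairing
    simp
  unfold Torus.nsGeneratorPairing
  rw [h2, h3, h4, eGradNormSq_rest]
  simp

/-- The floor inequality of `MirrorFloorTG` at the state of rest, for the certificate `(Φ₁, θ₁)`, holds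
iff `ε₀ ≤ (f, Φ₁'(0))`. -/
theorem floor_at_rest_iff (ν θ₁ ε₀ : ℝ) (f : (UnitAddTorus (Fin 3) → EuclideanSpace ℝ (Fin 3))) (Φ₁ : Torus.CylindricalTest (Fin 3)) :
    (ε₀ ≤ ν * (Torus.eGradNormSq (((0 : Torus.energySpace (Fin 3)) : Lp (EuclideanSpace ℝ (Fin 3)) 2 (volume : Measure (UnitAddTorus (Fin 3)))) : (UnitAddTorus (Fin 3) → EuclideanSpace ℝ (Fin 3)))).toReal +
        Torus.nsGeneratorPairing ν f (0 : Torus.energySpace (Fin 3)) (Φ₁.grad 0) +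
        2 * θ₁ * (Torus.pairing ((0 : Torus.energySpace (Fin 3)) : Lp (EuclideanSpace ℝ (Fin 3)) 2 (volume : Measure (UnitAddTorus (Fin 3)))) f - ν * (Torus.eGradNormSq (((0 : Torus.energySpace (Fin 3)) : Lp (EuclideanSpace ℝ (Fin 3)) 2 (volume : Measure (UnitAddTorus (Fin 3)))) : (UnitAddTorus (Fin 3) → EuclideanSpace ℝ (Fin 3)))).toReal)) ↔
      ε₀ ≤ ∫ x, ⟪f x, Φ₁.grad (0 : Torus.energySpace (Fin 3)) x⟫_ℝ := by
  rw [certificate_at_rest]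

/-- **The generator term is load-bearing.** A certificate whose differential at rest does not correlate
positively with the force certifies no positive floor (whatever the weight `θ₁`): the floor inequality of
`MirrorFloorTG` fails at the state of rest, which lies in every slab (`rest_mem_slab`). In particular the
energy multiplier alone (`Φ₁' ≡ 0`) never certifies. -/
theorem not_floor_at_rest_of_drift_nonpos {ν θ₁ ε₀ : ℝ} {f : (UnitAddTorus (Fin 3) → EuclideanSpace ℝ (Fin 3))} {Φ₁ : Torus.CylindricalTest (Fin 3)}
    (hε₀ : 0 < ε₀) (hdrift : (∫ x, ⟪f x, Φ₁.grad (0 : Torus.energySpace (Fin 3)) x⟫_ℝ) ≤ 0) :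
    ¬ (ε₀ ≤ ν * (Torus.eGradNormSq (((0 : Torus.energySpace (Fin 3)) : Lp (EuclideanSpace ℝ (Fin 3)) 2 (volume : Measure (UnitAddTorus (Fin 3)))) : (UnitAddTorus (Fin 3) → EuclideanSpace ℝ (Fin 3)))).toReal +
        Torus.nsGeneratorPairing ν f (0 : Torus.energySpace (Fin 3)) (Φ₁.grad 0) +
        2 * θ₁ * (Torus.pairing ((0 : Torus.energySpace (Fin 3)) : Lp (EuclideanSpace ℝ (Fin 3)) 2 (volume : Measure (UnitAddTorus (Fin 3)))) f - ν * (Torus.eGradNormSq (((0 : Torus.energySpace (Fin 3)) : Lp (EuclideanSpace ℝ (Fin 3)) 2 (volume : Measure (UnitAddTorus (Fin 3)))) : (UnitAddTorus (Fin 3) → EuclideanSpace ℝ (Fin 3)))).toReal)) := by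
  rw [floor_at_rest_iff]
  intro h
  linarith

/-! ## §3 Steady mirror states: the necessary condition and the kill switch -/

/-- `f_TG ∈ L²(T³)`. -/
theorem memLp_tgForce : MemLp tgForce 2 (volume : Measure (UnitAddTorus (Fin 3))) :=
  isSmooth_tgForce.memLp 2

/-- **Steady mirror states below the level are loud (necessary condition of the crux).** If
`MirrorFloorTG` holds then for every level `E > 0` there are `ε₀, ν₀ > 0` such that for `ν ∈ (0, ν₀)`
every steady weak solution `u ∈ V` of NS_ν(f_TG) with a.e. K-symmetric representative and `‖u‖² ≤ E`
has `ν ‖∇u‖² ≥ ε₀`. Proof: instantiate the floor at `u`; the generator pairing vanishes because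
`Φ₁'(u)` is a smooth divergence-free mean-zero test field, and the energy channel vanishes by the energy
equation of steady weak solutions (`d = 3 ≤ 4`). -/
theorem steadyStates_loud_of_mirrorFloorTG (hA : MirrorFloorTG) (E : ℝ) (hE : 0 < E) :
    ∃ ε₀ ν₀ : ℝ, 0 < ε₀ ∧ 0 < ν₀ ∧ ∀ ν : ℝ, 0 < ν → ν < ν₀ → ∀ u : Torus.energySpace (Fin 3),
      (u : Lp (EuclideanSpace ℝ (Fin 3)) 2 (volume : Measure (UnitAddTorus (Fin 3)))) ∈ Torus.energySpaceV (Fin 3) → Torus.IsSteadyWeakSolution ν tgForce u →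
      (∀ i j : Fin 3, (fun x => ((u : Lp (EuclideanSpace ℝ (Fin 3)) 2 (volume : Measure (UnitAddTorus (Fin 3)))) : (UnitAddTorus (Fin 3) → EuclideanSpace ℝ (Fin 3))) (Function.update x i (-x i)) j) =ᵐ[volume]
        (fun x => if j = i then -(((u : Lp (EuclideanSpace ℝ (Fin 3)) 2 (volume : Measure (UnitAddTorus (Fin 3)))) : (UnitAddTorus (Fin 3) → EuclideanSpace ℝ (Fin 3))) x j) else ((u : Lp (EuclideanSpace ℝ (Fin 3)) 2 (volume : Measure (UnitAddTorus (Fin 3)))) : (UnitAddTorus (Fin 3) → EuclideanSpace ℝ (Fin 3))) x j)) →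
      ‖u‖ ^ 2 ≤ E → ε₀ ≤ ν * (Torus.eGradNormSq ((u : Lp (EuclideanSpace ℝ (Fin 3)) 2 (volume : Measure (UnitAddTorus (Fin 3)))) : (UnitAddTorus (Fin 3) → EuclideanSpace ℝ (Fin 3)))).toReal := by
  obtain ⟨ε₀, ν₀, hε₀, hν₀, h⟩ := hA tgForce rfl E hE
  refine ⟨ε₀, ν₀, hε₀, hν₀, fun ν hν hνlt u hV hst hsym hEu => ?_⟩
  obtain ⟨Φ₁, θ₁, -, hfl⟩ := h ν hν hνlt
  have hfin : Torus.eGradNormSq ((u : Lp (EuclideanSpace ℝ (Fin 3)) 2 (volume : Measure (UnitAddTorus (Fin 3)))) : (UnitAddTorus (Fin 3) → EuclideanSpace ℝ (Fin 3))) ≠ ⊤ := hV.2.eGradNormSq_lt_top.ne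
  have key := hfl u hsym hfin hEu
  have hgen : Torus.nsGeneratorPairing ν tgForce u (Φ₁.grad u) = 0 :=
    hst (Φ₁.grad u) (Torus.CylindricalTest.isSmooth_grad_holds Φ₁ u)
      (Torus.CylindricalTest.isDivFree_grad_holds Φ₁ u) (Torus.CylindricalTest.hasZeroMean_grad_holds Φ₁ u)
  have hchan : Torus.pairing (u : Lp (EuclideanSpace ℝ (Fin 3)) 2 (volume : Measure (UnitAddTorus (Fin 3)))) tgForce - ν * (Torus.eGradNormSq ((u : Lp (EuclideanSpace ℝ (Fin 3)) 2 (volume : Measure (UnitAddTorus (Fin 3)))) : (UnitAddTorus (Fin 3) → EuclideanSpace ℝ (Fin 3)))).toReal = 0 := by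
    rw [← Torus.IsSteadyWeakSolution.energy_eq' (by simp) memLp_tgForce hV hst, sub_self]
  simp only [hgen, hchan, add_zero, mul_zero] at key
  exact key

/-- **Kill switch (steady states).** ONE level `E` and a sequence of steady weak solutions `uₙ ∈ V` of
NS_{νₙ}(f_TG) with a.e. K-symmetric representatives, along `νₙ → 0⁺`, with bounded energy
`‖uₙ‖² ≤ E` and vanishing dissipation `νₙ ‖∇uₙ‖² → 0`, refutes `MirrorFloorTG`. -/
theorem not_mirrorFloorTG_of_quietSteadyStates {E : ℝ} (hE : 0 < E) (νs : ℕ → ℝ) (u : ℕ → Torus.energySpace (Fin 3))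
    (hν : ∀ n, 0 < νs n) (hν0 : Tendsto νs atTop (𝓝 0))
    (hV : ∀ n, ((u n : Lp (EuclideanSpace ℝ (Fin 3)) 2 (volume : Measure (UnitAddTorus (Fin 3))))) ∈ Torus.energySpaceV (Fin 3))
    (hsteady : ∀ n, Torus.IsSteadyWeakSolution (νs n) tgForce (u n))
    (hK : ∀ n, ∀ i j : Fin 3, (fun x => ((u n : Lp (EuclideanSpace ℝ (Fin 3)) 2 (volume : Measure (UnitAddTorus (Fin 3)))) : (UnitAddTorus (Fin 3) → EuclideanSpace ℝ (Fin 3))) (Function.update x i (-x i)) j) =ᵐ[volume]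
        (fun x => if j = i then -(((u n : Lp (EuclideanSpace ℝ (Fin 3)) 2 (volume : Measure (UnitAddTorus (Fin 3)))) : (UnitAddTorus (Fin 3) → EuclideanSpace ℝ (Fin 3))) x j) else ((u n : Lp (EuclideanSpace ℝ (Fin 3)) 2 (volume : Measure (UnitAddTorus (Fin 3)))) : (UnitAddTorus (Fin 3) → EuclideanSpace ℝ (Fin 3))) x j))
    (hEn : ∀ n, ‖u n‖ ^ 2 ≤ E)
    (hquiet : Tendsto (fun n => νs n * (Torus.eGradNormSq ((u n : Lp (EuclideanSpace ℝ (Fin 3)) 2 (volume : Measure (UnitAddTorus (Fin 3)))) : (UnitAddTorus (Fin 3) → EuclideanSpace ℝ (Fin 3)))).toReal) atTop (𝓝 0)) :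
    ¬ MirrorFloorTG := by
  intro hA
  obtain ⟨ε₀, ν₀, hε₀, hν₀, hl⟩ := steadyStates_loud_of_mirrorFloorTG hA E hE
  have h1 : ∀ᶠ n in atTop, νs n < ν₀ := hν0.eventually (gt_mem_nhds hν₀)
  have h2 : ∀ᶠ n in atTop, νs n * (Torus.eGradNormSq ((u n : Lp (EuclideanSpace ℝ (Fin 3)) 2 (volume : Measure (UnitAddTorus (Fin 3)))) : (UnitAddTorus (Fin 3) → EuclideanSpace ℝ (Fin 3)))).toReal < ε₀ :=
    hquiet.eventually (gt_mem_nhds hε₀)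
  obtain ⟨n, hn1, hn2⟩ := (h1.and h2).exists
  have key := hl (νs n) (hν n) hn1 (u n) (hV n) (hsteady n) (hK n) (hEn n)
  exact absurd (key.trans_lt hn2) (lt_irrefl _)

end Summit.AnomalousDissipation.AnomalousDissipation.Theorems.MirrorFloorTG.Negative

end
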